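import Summits.ResolutionOfSingularities.ResolutionOfSingularities.Theorems.WeightedInvariantRatContactDescent
import Summits.ResolutionOfSingularities.ResolutionOfSingularities.Theorems.WeightedInvariantIota3EpsTorus
import Mathlib.RingTheory.PolynomialAlgebra
import Mathlib.RingTheory.KrullDimension.Polynomial
import HarnessLib

/-!
# ONE-MEMBER (σ-RATIO) DESCENT IN DIMENSION TWO, by the cone trick `S ↦ S[X]_(𝔪,X)` over the tree's dimension-three theorem
# (door `HypersurfaceCentreConstruction`, stmt-ResolutionOfSingularities-19897; P3 rung `stub_keyRungGrHomLE_three`, gap (σ-ext) at `dim ≤ 2`)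

Topic: `Summits/ResolutionOfSingularities/ResolutionOfSingularities/Theorems`. Helper for the door item
`HypersurfaceCentreConstruction` (stmt-ResolutionOfSingularities-19897, route `WeightedInvariant`), line `local-engine` (L W4.3),
def-free.  The gap list `keyRungGrHomLE_three_of_sigmaExt` (…KeyRungThreeOfSigmaExt) carries (σ-ext) «σ is invariant along
𝔪-preserving local formally smooth e.f.t. homomorphisms of regular local rings INTO DIMENSION ≤ 3»; at dimension `2` the σ-letters
collapse to the ONE-FLAG rational contact weights (sequel file), whose descent is proved here:

**What is proved.** `φ : S → S'` local, formally smooth, essentially of finite type between regular local rings of dimension TWO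
with `𝔪_S S' = 𝔪_{S'}`, `f ∈ 𝔪_S ∖ 0`, `ν = ord f`, `0 < b`:
`Iota3.RatContact.OneFlagReaches (φ f) ν a b → OneFlagReaches f ν a b` (`oneFlagReaches_of_algebraMap_dim2`, `iff` form
`oneFlagReaches_algebraMap_iff_dim2`).

**Proof (the cone trick).**  Let `𝔐 = (𝔪_S, X) ⊂ S[X]` and `S₃ = S[X]_𝔐` (regular local of dimension three), likewise `S'₃`; the
induced `φ₃ : S₃ → S'₃` is local, formally smooth, essentially of finite type with `𝔪_{S₃} S'₃ = 𝔪_{S'₃}`.  Slopes `a/b ≤ 1` are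
reached by every parameter.  For `b < a`: push the upstairs witness `g'` to `S'₃` (it stays a regular parameter: the retraction
`π' : S'₃ → S'`, `X ↦ 0`, maps `𝔪₃'` into `𝔪'`), apply the tree's dimension-three descent `JFlatEssSmooth.oneFlagReaches_of_algebraMap`
(p563…, Hironaka's vertex preparation) along `φ₃` to get a regular parameter `y₃ ∈ S₃` carrying `f` to `a/b`, and retract:
`π : S₃ → S`, `X ↦ 0`, is a ring homomorphism with `π(𝔪₃) ⊆ 𝔪` fixing `S`, so `f = π f ∈ π(RC_{y₃}(a,b)(aν)) ⊆ RC_{π y₃}(a,b)(aν)`;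
and `π y₃ ∉ 𝔪²` because a slope `> 1` pins the tangent cone, `f ≡ c·y₃^ν (mod 𝔪₃^{ν+1})`, whence `f ≡ π(c)·(π y₃)^ν (mod 𝔪^{ν+1})`
and `π y₃ ∈ 𝔪²` would force `f ∈ 𝔪^{ν+1}`.

* §1 the cone point and the retraction (`RatContactCone.exists_retraction`, order and parameters along `S → S₃`);
* §2 transport of the rational filtration along ring homomorphisms mapping `𝔪` into `𝔪`;
* §3 the cone of an essentially smooth 𝔪-preserving local map (instances, `𝔪₃ S'₃ = 𝔪₃'`, dimension `d + 1`);
* §4 `oneFlagReaches_of_algebraMap_dim2`, `oneFlagReaches_algebraMap_iff_dim2`.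

[OURS · L1 W4.3 · (σ-ext) at dimension 2]  Replaces the role of NO printed item; NOT a statement of the manuscript
[claim: Hironaka2017, status: under-review]. AI work, weaker than expert review.  No definition; no axiom; no named fact beyond those
of the dimension-three theorem.

## References

* H. Hironaka, *Characteristic polyhedra of singularities*, J. Math. Kyoto Univ. 7 (1967), §3, Thm. (4.8). [Hironaka1967]
* A. Grothendieck, *EGA IV*, Publ. Math. IHÉS 20 (1964), 0_IV (19.3.5) (base change of formal smoothness), (19.7.1). [EGA0IV]
* H. Matsumura, *Commutative Ring Theory* (1987), Thm. 15.4, Thm. 19.5. [Matsumura1987]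
-/

noncomputable section

open IsLocalRing Polynomial Literature.AlgebraicGeometry.Resolution
open Summit.ResolutionOfSingularities.ResolutionOfSingularities.Cruxes.HypersurfaceCentreConstruction.LocalEngine
open Summit.ResolutionOfSingularities.ResolutionOfSingularities.Cruxes.HypersurfaceCentreConstruction.LocalEngine.Iota3
open Summit.ResolutionOfSingularities.ResolutionOfSingularities.Cruxes.HypersurfaceCentreConstruction.LocalEngine.Iota3.RatContact

set_option linter.dupNamespace false -- mandated namespace of this single-conjunct summit

namespace Summit.ResolutionOfSingularities.ResolutionOfSingularities.Theorems

namespace RatContactCone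

/-! ## §1 The cone point `𝔐 = (𝔪, X) ⊂ S[X]` and the retraction `X ↦ 0` -/

section Cone

variable {S : Type} [CommRing S] [IsLocalRing S] (𝔐 : Ideal S[X])
  (h𝔐 : ∀ p : S[X], p ∈ 𝔐 ↔ p.eval 0 ∈ maximalIdeal S)
include h𝔐

/-- `X ∈ (𝔪, X)`. [folklore] -/
theorem X_mem : (X : S[X]) ∈ 𝔐 := (h𝔐 X).mpr (by rw [eval_X]; exact (maximalIdeal S).zero_mem)

/-- `C s ∈ (𝔪, X) ↔ s ∈ 𝔪`. [folklore] -/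
theorem C_mem_iff (s : S) : C s ∈ 𝔐 ↔ s ∈ maximalIdeal S := by rw [h𝔐, eval_C]

/-- `(𝔪, X) ∩ S = 𝔪`. [folklore] -/
theorem comap_C_eq : 𝔐.comap (C : S →+* S[X]) = maximalIdeal S :=
  Ideal.ext fun s => by rw [Ideal.mem_comap, C_mem_iff 𝔐 h𝔐]

/-- Off `(𝔪, X)` the constant term is a unit. [folklore] -/
theorem isUnit_eval_zero_of_not_mem {p : S[X]} (hp : p ∉ 𝔐) : IsUnit (p.eval 0) := by
  by_contra hu
  exact hp ((h𝔐 p).mpr ((IsLocalRing.mem_maximalIdeal _).mpr (mem_nonunits_iff.mpr hu)))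

variable [𝔐.IsPrime]

/-- **The retraction `X ↦ 0`**: a ring homomorphism `π : S[X]_𝔐 → S` with `π (p/1) = p(0)` (so `π ∘ (S → S[X]_𝔐) = id`) mapping
`𝔪_{S[X]_𝔐}` into `𝔪_S` (hence local). [folklore] -/
theorem exists_retraction :
    ∃ π : Localization.AtPrime 𝔐 →+* S,
      (∀ p : S[X], π (algebraMap S[X] (Localization.AtPrime 𝔐) p) = p.eval 0) ∧
      (∀ s : S, π (algebraMap S (Localization.AtPrime 𝔐) s) = s) ∧
      (maximalIdeal (Localization.AtPrime 𝔐)).map π ≤ maximalIdeal S ∧ IsLocalHom π := by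
  have hunit : ∀ y : 𝔐.primeCompl, IsUnit ((evalRingHom 0 : S[X] →+* S) y) := fun y =>
    isUnit_eval_zero_of_not_mem 𝔐 h𝔐 y.2
  have hle : (maximalIdeal (Localization.AtPrime 𝔐)).map (IsLocalization.lift (M := 𝔐.primeCompl) hunit) ≤ maximalIdeal S := by
    rw [← Localization.AtPrime.map_eq_maximalIdeal, Ideal.map_map, IsLocalization.lift_comp, Ideal.map_le_iff_le_comap]
    exact fun p hp => Ideal.mem_comap.mpr ((h𝔐 p).mp hp)
  refine ⟨IsLocalization.lift (M := 𝔐.primeCompl) hunit, fun p => IsLocalization.lift_eq hunit p, fun s => ?_, hle,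
    ((IsLocalRing.local_hom_TFAE _).out 0 2).mpr hle⟩
  rw [IsScalarTower.algebraMap_apply S S[X] (Localization.AtPrime 𝔐), IsLocalization.lift_eq, Polynomial.algebraMap_eq]
  change (C s).eval 0 = s
  rw [eval_C]

/-- Along `S → S[X]_𝔐` (both ways local thanks to the retraction) the `𝔪`-adic order is unchanged. [folklore] -/
theorem adicOrder_algebraMap_cone [IsLocalHom (algebraMap S (Localization.AtPrime 𝔐))] (f : S) :
    adicOrder (algebraMap S (Localization.AtPrime 𝔐) f) = adicOrder f := by
  obtain ⟨π, -, hπS, -, hπloc⟩ := exists_retraction 𝔐 h𝔐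
  refine le_antisymm ?_ (adicOrder_le_adicOrder_map _ f)
  have h := adicOrder_le_adicOrder_map π (algebraMap S (Localization.AtPrime 𝔐) f)
  rwa [hπS] at h

/-- `S → S[X]_𝔐` is injective on the nose: `f/1 = 0 → f = 0` (retract). [folklore] -/
theorem eq_zero_of_algebraMap_cone_eq_zero {f : S} (h : algebraMap S (Localization.AtPrime 𝔐) f = 0) : f = 0 := by
  obtain ⟨π, -, hπS, -, -⟩ := exists_retraction 𝔐 h𝔐
  rw [← hπS f, h, map_zero]

end Cone

/-! ## §2 Transport of the rational filtration along a ring homomorphism mapping `𝔪` into `𝔪` -/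

section Transport

variable {A B : Type} [CommRing A] [CommRing B] [IsLocalRing A] [IsLocalRing B]

/-- `ψ(RC_g(a,b)(n)) ⊆ RC_{ψ g}(a,b)(n)` for a ring homomorphism with `ψ(𝔪_A) ⊆ 𝔪_B`. [folklore] -/
theorem map_ratContactFiltration_le (ψ : A →+* B) (hψ : (maximalIdeal A).map ψ ≤ maximalIdeal B) (g : A) (a b n : ℕ) :
    (ratContactFiltration g a b n).map ψ ≤ ratContactFiltration (ψ g) a b n := by
  simp only [ratContactFiltration_def, Ideal.map_iSup, Ideal.map_mul, Ideal.map_pow, Ideal.map_span, Set.image_singleton,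
    map_pow]
  exact iSup_mono fun α => Ideal.mul_mono_right (Ideal.pow_right_mono hψ _)

/-- Powers of the maximal ideal go to powers of the maximal ideal. [folklore] -/
theorem map_mem_maximalIdeal_pow (ψ : A →+* B) (hψ : (maximalIdeal A).map ψ ≤ maximalIdeal B) {x : A} {n : ℕ}
    (hx : x ∈ maximalIdeal A ^ n) : ψ x ∈ maximalIdeal B ^ n := by
  have h : (maximalIdeal A ^ n).map ψ ≤ maximalIdeal B ^ n := by rw [Ideal.map_pow]; exact Ideal.pow_right_mono hψ n
  exact h (Ideal.mem_map_of_mem ψ hx)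

/-- **A one-flag reach RETRACTS**: `ψ : A → B` with `ψ(𝔪_A) ⊆ 𝔪_B`, `F ∈ A` with `ψ F ∉ 𝔪_B^{ν+1}`, `b < a`; if a `g ∈ 𝔪_A` carries `F`
to `a/b` then `ψ g` is a regular parameter of `B` carrying `ψ F` to `a/b` (the slope `> 1` pins the tangent cone:
`F ≡ c g^ν`, so `ψ g ∈ 𝔪_B²` would put `ψ F` in `𝔪_B^{ν+1}`). [folklore] -/
theorem oneFlagReaches_map_of_slope_gt (ψ : A →+* B) (hψ : (maximalIdeal A).map ψ ≤ maximalIdeal B) {F g : A}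
    (hg : g ∈ maximalIdeal A) {ν a b : ℕ} (hν : 1 ≤ ν) (hb : 0 < b) (hab : b < a)
    (hF : ψ F ∉ maximalIdeal B ^ (ν + 1)) (h : F ∈ ratContactFiltration g a b (a * ν)) :
    ψ g ∈ maximalIdeal B ∧ ψ g ∉ maximalIdeal B ^ 2 ∧ ψ F ∈ ratContactFiltration (ψ g) a b (a * ν) := by
  refine ⟨hψ (Ideal.mem_map_of_mem ψ hg), fun h2 => hF ?_, map_ratContactFiltration_le ψ hψ g a b _ (Ideal.mem_map_of_mem ψ h)⟩
  obtain ⟨c, hc⟩ := exists_sub_mul_pow_mem_of_mem_ratContactFiltration hg hb hab h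
  have h1 : ψ F - ψ c * ψ g ^ ν ∈ maximalIdeal B ^ (ν + 1) := by
    simpa only [map_sub, map_mul, map_pow] using map_mem_maximalIdeal_pow ψ hψ hc
  have h2' : ψ c * ψ g ^ ν ∈ maximalIdeal B ^ (ν + 1) := by
    have hpow : ψ g ^ ν ∈ maximalIdeal B ^ (2 * ν) := by rw [pow_mul]; exact Ideal.pow_mem_pow h2 ν
    exact Ideal.mul_mem_left _ _ (Ideal.pow_le_pow_right (by omega) hpow)
  simpa using Ideal.add_mem _ h1 h2'

end Transport

/-! ## §3 The cone of an essentially smooth `𝔪`-preserving local map -/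

section ConeMap

variable {S S' : Type} [CommRing S] [CommRing S'] [IsLocalRing S] [IsLocalRing S'] [Algebra S S']
  [IsLocalHom (algebraMap S S')]
  (𝔐 : Ideal S[X]) (h𝔐 : ∀ p : S[X], p ∈ 𝔐 ↔ p.eval 0 ∈ maximalIdeal S)
  (𝔐' : Ideal S'[X]) (h𝔐' : ∀ p : S'[X], p ∈ 𝔐' ↔ p.eval 0 ∈ maximalIdeal S')
include h𝔐 h𝔐'

/-- The cone points correspond: `(𝔪', X) ∩ S[X] = (𝔪, X)` (`φ` is local). [folklore] -/
theorem comap_cone_eq : 𝔐'.comap (mapRingHom (algebraMap S S')) = 𝔐 := by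
  have hcm : (maximalIdeal S').comap (algebraMap S S') = maximalIdeal S :=
    ((IsLocalRing.local_hom_TFAE (algebraMap S S')).out 0 4).mp ‹IsLocalHom (algebraMap S S')›
  ext p
  rw [Ideal.mem_comap, h𝔐', h𝔐, ← hcm, Ideal.mem_comap, Polynomial.coe_mapRingHom, eval_zero_map]

/-- The cone points correspond: `(𝔪, X) S'[X] = (𝔪', X)` when `𝔪 S' = 𝔪'`. [folklore] -/
theorem map_cone_eq (h𝔪 : (maximalIdeal S).map (algebraMap S S') = maximalIdeal S') :
    𝔐.map (mapRingHom (algebraMap S S')) = 𝔐' := by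
  refine le_antisymm (Ideal.map_le_iff_le_comap.mpr (comap_cone_eq 𝔐 h𝔐 𝔐' h𝔐').ge) fun p hp => ?_
  -- `p = C (p 0) + X q`, `p 0 ∈ 𝔪' = 𝔪 S'`
  have hC : C (p.eval 0) ∈ 𝔐.map (mapRingHom (algebraMap S S')) := by
    have h1 : C (p.eval 0) ∈ ((maximalIdeal S).map (algebraMap S S')).map (C : S' →+* S'[X]) :=
      Ideal.mem_map_of_mem _ (h𝔪 ▸ (h𝔐' p).mp hp)
    rw [Ideal.map_map] at h1
    have h2 : ((maximalIdeal S).map ((C : S' →+* S'[X]).comp (algebraMap S S'))) =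
        ((maximalIdeal S).map (C : S →+* S[X])).map (mapRingHom (algebraMap S S')) := by
      rw [Ideal.map_map, Polynomial.mapRingHom_comp_C]
    rw [h2] at h1
    exact Ideal.map_mono (Ideal.map_le_iff_le_comap.mpr fun s hs => (C_mem_iff 𝔐 h𝔐 s).mpr hs) h1
  have hX : (X : S'[X]) ∈ 𝔐.map (mapRingHom (algebraMap S S')) := by
    have := Ideal.mem_map_of_mem (mapRingHom (algebraMap S S')) (X_mem 𝔐 h𝔐)
    rwa [Polynomial.coe_mapRingHom, Polynomial.map_X] at this
  obtain ⟨q, hq⟩ := Polynomial.X_dvd_sub_C (p := p)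
  have hp' : p = C (p.coeff 0) + X * q := by rw [← hq]; ring
  rw [hp', Polynomial.coeff_zero_eq_eval_zero]
  exact Ideal.add_mem _ hC (Ideal.mul_mem_right _ _ hX)

end ConeMap

/-! ## §4 One-member descent in dimension two -/

section DimTwo

variable {S S' : Type} [CommRing S] [CommRing S'] [IsRegularLocalRing S] [IsRegularLocalRing S'] [Algebra S S']
  [IsLocalHom (algebraMap S S')] [Algebra.FormallySmooth S S'] [Algebra.EssFiniteType S S']

/-- The dimension of the cone: `dim S[X]_(𝔪,X) = dim S + 1`. [cite: Matsumura1987, Thm. 15.4] -/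
theorem ringKrullDim_cone (𝔐 : Ideal S[X]) [𝔐.IsMaximal] (h𝔐 : ∀ p : S[X], p ∈ 𝔐 ↔ p.eval 0 ∈ maximalIdeal S) {d : ℕ}
    (hdim : ringKrullDim S = (d : ℕ)) : ringKrullDim (Localization.AtPrime 𝔐) = ((d + 1 : ℕ) : WithBot ℕ∞) := by
  haveI : 𝔐.LiesOver (maximalIdeal S) := ⟨by rw [Ideal.under_def, Polynomial.algebraMap_eq, comap_C_eq 𝔐 h𝔐]⟩
  have hS : ((maximalIdeal S).height : WithBot ℕ∞) = (d : ℕ) := by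
    rw [IsLocalRing.maximalIdeal_height_eq_ringKrullDim]; exact hdim
  have hS' : (maximalIdeal S).height = d := by exact_mod_cast hS
  rw [IsLocalization.AtPrime.ringKrullDim_eq_height 𝔐 (Localization.AtPrime 𝔐),
    Polynomial.height_eq_height_add_one (maximalIdeal S) 𝔐, hS']
  rfl

/-- **ONE-MEMBER (σ-RATIO) DESCENT IN DIMENSION TWO.**  `φ : S → S'` local, formally smooth, essentially of finite type between
regular local rings of dimension two with `𝔪_S S' = 𝔪_{S'}`; `f ∈ 𝔪_S ∖ 0`, `ν = ord f`, `0 < b`.  If a regular parameter of `S'`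
carries `φ f` to the rational contact weight `a/b`, then a regular parameter of `S` carries `f` to the same weight.  Proof: the cone
trick over `JFlatEssSmooth.oneFlagReaches_of_algebraMap` (dimension three). [cite: Hironaka1967, §3, Thm. (4.8)]
[cite: EGA0IV, 0_IV (19.3.5), (19.7.1)] [OURS · L1 W4.3 · (σ-ext) at dimension 2] -/
theorem oneFlagReaches_of_algebraMap_dim2 (h𝔪 : (maximalIdeal S).map (algebraMap S S') = maximalIdeal S')
    (hdim : ringKrullDim S = (2 : ℕ)) (hdim' : ringKrullDim S' = (2 : ℕ)) {f : S} (hf0 : f ≠ 0) (hf : f ∈ maximalIdeal S)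
    {b : ℕ} (hb : 0 < b) (a : ℕ) :
    OneFlagReaches (algebraMap S S' f) (adicOrder f).toNat a b → OneFlagReaches f (adicOrder f).toNat a b := by
  intro h
  obtain ⟨hν, hfν, hford⟩ := EssSmoothLevels.adicOrder_toNat_spec hf0 hf
  -- a regular parameter of `S` (dimension `2 ≠ 0`)
  obtain ⟨x, hx, hx2⟩ : ∃ x ∈ maximalIdeal S, x ∉ maximalIdeal S ^ 2 :=
    SetLike.exists_of_lt (IsLocalRing.maximalIdeal_sq_lt_of_ringKrullDim_ne_zero (by rw [hdim]; norm_num))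
  by_cases hab : a ≤ b
  · exact RatContactEssSmooth.oneFlagReaches_of_le hx hx2 hab hb hfν
  have hba : b < a := Nat.lt_of_not_le hab
  -- the cone points
  set 𝔐 : Ideal S[X] := (maximalIdeal S).comap (evalRingHom 0 : S[X] →+* S) with h𝔐def
  set 𝔐' : Ideal S'[X] := (maximalIdeal S').comap (evalRingHom 0 : S'[X] →+* S') with h𝔐'def
  have h𝔐 : ∀ p : S[X], p ∈ 𝔐 ↔ p.eval 0 ∈ maximalIdeal S := fun p => Ideal.mem_comap
  have h𝔐' : ∀ p : S'[X], p ∈ 𝔐' ↔ p.eval 0 ∈ maximalIdeal S' := fun p => Ideal.mem_comap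
  haveI : 𝔐.IsMaximal := Ideal.comap_isMaximal_of_surjective _ fun s => ⟨C s, eval_C⟩
  haveI : 𝔐'.IsMaximal := Ideal.comap_isMaximal_of_surjective _ fun s => ⟨C s, eval_C⟩
  -- the cone rings `S₃ = S[X]_𝔐`, `S'₃ = S'[X]_𝔐'`
  haveI : IsRegularLocalRing (Localization.AtPrime 𝔐) := Iota3.isRegularLocalRing_localization_polynomial S 𝔐
  haveI : IsRegularLocalRing (Localization.AtPrime 𝔐') := Iota3.isRegularLocalRing_localization_polynomial S' 𝔐'
  haveI : IsLocalHom (algebraMap S (Localization.AtPrime 𝔐)) :=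
    Iota3.isLocalHom_algebraMap_localization_polynomial S 𝔐 (comap_C_eq 𝔐 h𝔐)
  haveI : IsLocalHom (algebraMap S' (Localization.AtPrime 𝔐')) :=
    Iota3.isLocalHom_algebraMap_localization_polynomial S' 𝔐' (comap_C_eq 𝔐' h𝔐')
  -- `S'[X]` as an `S[X]`-algebra along `φ` (Mathlib's non-global `Polynomial.algebra`: base change of `φ`)
  letI : Algebra S[X] S'[X] := Polynomial.algebra S S'
  have hcomap : 𝔐'.comap (algebraMap S[X] S'[X]) = 𝔐 := comap_cone_eq 𝔐 h𝔐 𝔐' h𝔐'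
  -- the induced local map `φ₃ : S₃ → S'₃`
  letI : Algebra (Localization.AtPrime 𝔐) (Localization.AtPrime 𝔐') :=
    (Localization.localRingHom 𝔐 𝔐' (algebraMap S[X] S'[X]) hcomap.symm).toAlgebra
  haveI : IsScalarTower S[X] (Localization.AtPrime 𝔐) (Localization.AtPrime 𝔐') :=
    IsScalarTower.of_algebraMap_eq fun p => by
      change _ = Localization.localRingHom 𝔐 𝔐' (algebraMap S[X] S'[X]) hcomap.symm (algebraMap S[X] _ p)
      rw [Localization.localRingHom_to_map, IsScalarTower.algebraMap_apply S[X] S'[X] (Localization.AtPrime 𝔐')]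
  haveI : IsLocalHom (algebraMap (Localization.AtPrime 𝔐) (Localization.AtPrime 𝔐')) :=
    Localization.isLocalHom_localRingHom 𝔐 𝔐' (algebraMap S[X] S'[X]) hcomap.symm
  -- formal smoothness / essential finiteness of `S[X] → S'[X]` (base change) and of `φ₃`
  haveI : Algebra.FormallySmooth S[X] S'[X] := Algebra.FormallySmooth.of_equiv (Algebra.IsPushout.equiv S S[X] S' S'[X])
  haveI : Algebra.EssFiniteType S[X] S'[X] :=
    (Algebra.EssFiniteType.iff_of_algEquiv (Algebra.IsPushout.equiv S S[X] S' S'[X])).mp inferInstance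
  haveI : Algebra.FormallySmooth S'[X] (Localization.AtPrime 𝔐') := Algebra.FormallySmooth.of_isLocalization 𝔐'.primeCompl
  haveI : Algebra.EssFiniteType S'[X] (Localization.AtPrime 𝔐') := Algebra.EssFiniteType.of_isLocalization _ 𝔐'.primeCompl
  haveI : Algebra.FormallySmooth S[X] (Localization.AtPrime 𝔐') := Algebra.FormallySmooth.comp S[X] S'[X] _
  haveI : Algebra.EssFiniteType S[X] (Localization.AtPrime 𝔐') := Algebra.EssFiniteType.comp S[X] S'[X] _
  haveI : Algebra.FormallySmooth (Localization.AtPrime 𝔐) (Localization.AtPrime 𝔐') :=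
    Algebra.FormallySmooth.localization_base 𝔐.primeCompl
  haveI : Algebra.EssFiniteType (Localization.AtPrime 𝔐) (Localization.AtPrime 𝔐') := Algebra.EssFiniteType.of_comp S[X] _ _
  -- `𝔪₃ S'₃ = 𝔪₃'`
  have h𝔪₃ : (maximalIdeal (Localization.AtPrime 𝔐)).map (algebraMap (Localization.AtPrime 𝔐) (Localization.AtPrime 𝔐')) =
      maximalIdeal (Localization.AtPrime 𝔐') := by
    rw [← Localization.AtPrime.map_eq_maximalIdeal, Ideal.map_map,
      ← IsScalarTower.algebraMap_eq S[X] (Localization.AtPrime 𝔐) (Localization.AtPrime 𝔐'),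
      IsScalarTower.algebraMap_eq S[X] S'[X] (Localization.AtPrime 𝔐'), ← Ideal.map_map, Polynomial.algebraMap_def,
      map_cone_eq 𝔐 h𝔐 𝔐' h𝔐' h𝔪,
      Localization.AtPrime.map_eq_maximalIdeal]
  -- dimensions
  have hdim₃ : ringKrullDim (Localization.AtPrime 𝔐) = (3 : ℕ) := ringKrullDim_cone 𝔐 h𝔐 hdim
  have hdim₃' : ringKrullDim (Localization.AtPrime 𝔐') = (3 : ℕ) := ringKrullDim_cone 𝔐' h𝔐' hdim'
  -- the element `F = f/1 ∈ S₃`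
  set F : Localization.AtPrime 𝔐 := algebraMap S (Localization.AtPrime 𝔐) f with hFdef
  have hF0 : F ≠ 0 := fun h0 => hf0 (eq_zero_of_algebraMap_cone_eq_zero 𝔐 h𝔐 h0)
  have hF : F ∈ maximalIdeal (Localization.AtPrime 𝔐) := map_nonunit (algebraMap S (Localization.AtPrime 𝔐)) f hf
  have hordF : adicOrder F = adicOrder f := adicOrder_algebraMap_cone 𝔐 h𝔐 f
  -- `φ₃ F = (φ f)/1`
  have hφF : algebraMap (Localization.AtPrime 𝔐) (Localization.AtPrime 𝔐') F =
      algebraMap S' (Localization.AtPrime 𝔐') (algebraMap S S' f) := by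
    rw [hFdef, IsScalarTower.algebraMap_apply S S[X] (Localization.AtPrime 𝔐),
      ← IsScalarTower.algebraMap_apply S[X] (Localization.AtPrime 𝔐) (Localization.AtPrime 𝔐'),
      IsScalarTower.algebraMap_apply S[X] S'[X] (Localization.AtPrime 𝔐'), Polynomial.algebraMap_eq,
      IsScalarTower.algebraMap_apply S' S'[X] (Localization.AtPrime 𝔐'), Polynomial.algebraMap_eq, Polynomial.algebraMap_def,
      Polynomial.coe_mapRingHom, Polynomial.map_C]
  -- push the upstairs witness to `S'₃`
  obtain ⟨π', -, hπ'S, hπ'le, -⟩ := exists_retraction 𝔐' h𝔐'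
  have hup : OneFlagReaches (algebraMap (Localization.AtPrime 𝔐) (Localization.AtPrime 𝔐') F) (adicOrder F).toNat a b := by
    rw [hφF, hordF]
    obtain ⟨g', hg', hg'2, hfg'⟩ := h
    have hφford : algebraMap S' (Localization.AtPrime 𝔐') (algebraMap S S' f) ∉
        maximalIdeal (Localization.AtPrime 𝔐') ^ ((adicOrder f).toNat + 1) := by
      intro hmem
      have h1 := map_mem_maximalIdeal_pow π' hπ'le hmem
      rw [hπ'S] at h1
      exact hford ((IotaOrderEssSmooth.mem_maximalIdeal_pow_iff_of_formallySmooth S S' _ f).mpr h1)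
    have hle : (maximalIdeal S').map (algebraMap S' (Localization.AtPrime 𝔐')) ≤ maximalIdeal (Localization.AtPrime 𝔐') :=
      ((IsLocalRing.local_hom_TFAE _).out 0 2).mp ‹_›
    obtain ⟨h1, h2, h3⟩ := oneFlagReaches_map_of_slope_gt (algebraMap S' (Localization.AtPrime 𝔐')) hle hg' hν hb hba hφford hfg'
    exact ⟨_, h1, h2, h3⟩
  -- dimension-three descent along `φ₃`
  have hdown : OneFlagReaches F (adicOrder F).toNat a b :=
    JFlatEssSmooth.oneFlagReaches_of_algebraMap h𝔪₃ hdim₃ hdim₃' hF0 hF hb a hup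
  -- retract to `S`
  rw [hordF] at hdown
  obtain ⟨y₃, hy₃, -, hFy₃⟩ := hdown
  obtain ⟨π, -, hπS, hπle, -⟩ := exists_retraction 𝔐 h𝔐
  have hπF : π F ∉ maximalIdeal S ^ ((adicOrder f).toNat + 1) := by rw [hFdef, hπS]; exact hford
  obtain ⟨h1, h2, h3⟩ := oneFlagReaches_map_of_slope_gt π hπle hy₃ hν hb hba hπF hFy₃
  rw [hFdef, hπS] at h3
  exact ⟨π y₃, h1, h2, h3⟩

/-- **One-member reach is the same upstairs and downstairs in dimension two** (`iff` form). [cite: Hironaka1967, §3, Thm. (4.8)]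
[cite: EGA0IV, 0_IV (19.7.1)] [OURS · L1 W4.3 · (σ-ext) at dimension 2] -/
theorem oneFlagReaches_algebraMap_iff_dim2 (h𝔪 : (maximalIdeal S).map (algebraMap S S') = maximalIdeal S')
    (hdim : ringKrullDim S = (2 : ℕ)) (hdim' : ringKrullDim S' = (2 : ℕ)) {f : S} (hf0 : f ≠ 0) (hf : f ∈ maximalIdeal S)
    {b : ℕ} (hb : 0 < b) (a : ℕ) :
    OneFlagReaches (algebraMap S S' f) (adicOrder f).toNat a b ↔ OneFlagReaches f (adicOrder f).toNat a b :=
  ⟨oneFlagReaches_of_algebraMap_dim2 h𝔪 hdim hdim' hf0 hf hb a, RatContactEssSmooth.oneFlagReaches_algebraMap h𝔪⟩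

end DimTwo

end RatContactCone

end Summit.ResolutionOfSingularities.ResolutionOfSingularities.Theorems

end
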